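/-
Copyright (c) 2026. All rights reserved.
Released under Apache 2.0 license as described in the file LICENSE.
-/
import Literature.Probability.FitznerVanDerHofstad2017.NobleBoundsNResidual
import Literature.Probability.FitznerVanDerHofstad2017.NobleBoundsNTargetsB
import Literature.Probability.FitznerVanDerHofstad2017.NobleBoundsNMidK2B
import HarnessLib

/-!
# The `N = M + 2` size-model inequality (5.34) with the product-form row `(1, ≥2 | d ≥ 2)`, modulo the six coincidence slots

Fitzner–van der Hofstad, *Mean-field behavior for nearest-neighbor percolation in `d > 10`* (arXiv:1506.07977v2 =
EJP 22 (2017) no. 43) [FvdH17], §5.1 (5.4), Prop. 5.5 (5.34), §6.1 (6.4)–(6.10), App. B Table `B^{(2),ι,a,b}`.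

The (β′) twin of `NobleBoundsNDispatchReg` / `NobleBoundsNDispatchAll` / `NobleBoundsNResidual`: the regular
target family `tgtReg` is replaced by `NobleBoundsNTargetsB.tgtRegB` — equal to it at every entry except
`(v, a₀, a′) = ((true, 2), 1, 2)`, where the printed joint pentagon of App. B row `(1, ≥2 | d_{C̃}(w,u) ≥ 2)` (p. 76)
is replaced by its BK product form `tgtK2B` — and the slot `hK2` of the landed dispatchers is DISCHARGED by the cell
packages `NobleBoundsNMidK2B.nonempty_jPkg_midE_K2B_lit` / `nonempty_jPkg_firstE_K2B_lit`.  Consequently: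

* §A `nonempty_jPkg_mid_regB` / `nonempty_jPkg_first_regB` — `pkg` at a middle / the first junction with a regular
  class pair for the target `tgtRegB …` from the two coincidence slots `hR′` (`F‴`, `a′ ≠ 0`, `w_{k+1} = t_k`) and
  `hR` (`F″` cut-through, `z_k = t_k ∼ w_{k+1}`) only (both slots keep their landed `tgtReg` targets, which agree
  with `tgtRegB` there); every other case is routed through the landed dispatcher by name;
* §B the global target family `tgtJB` by class pair and its column bound against
  `secStarBpt (blockBFullptB' 𝐋 X) 2 0` (the `★` entries are the landed ones, `NobleBoundsNTargetsB.sec*_blockBFullptB'`);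
* §C–§D the per-junction targets `tgtAllB`, `pkg` at every junction from per-pair packages (`nonempty_jPkg_allB`), the
  class estimate `h2` (`prod_bondJ_mul_piPerc_jwCover_le_secStarB_of_pairPackages`);
* §E (5.34) at `N = n + 1` from a cover with class estimates against the (β′) pointwise block
  (`tsum_nobleXiT_le_secStarB'_of_cover`, the (β′) copy of `NobleBoundsNCoverPrime.tsum_nobleXiT_le_secStar'_of_cover`
  over the generic `NobleBoundsNCover.nobleXiT_le_recP_chain_of_cover`), and at `N = M + 2` from per-pair packages;
* §F `nonempty_jPkg_all_of_residualsB`, `tsum_nobleXiT_le_secStarB'_of_residuals` — (5.34) at `N = M + 2`,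
  `Σ_x Ξ̂^{(M+2)}(x) ≤ (P^S)ᵗ · B_sec^{M+1} · Ā_sec · P^E` over `Fin 3 ⊕ Unit` with the regular block
  `starB (blockBFullB' 𝐋 X₂) (secEc (blockBFullpt' 𝐋 X) 0) (secEo … 2) (secEoc … 2 0)` (ONLY the first argument of
  `starB` differs from `NobleBoundsNResidual`), granted the SIX coincidence slots R′ / R at the first pair, the middle
  regular pairs and the middle lower-`★` pairs.

Nothing is cited as fact: every statement is a composition of landed theorems and of the (β′) cell packages; the
product form is an upper bound of the printed row's configurations by the BK inequality ((4.16)–(4.18), pp. 35–36),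
weaker than the printed letter, and its numerical price belongs to the numerics side of the packet (`k2b`).
ADDITIVE: no existing declaration is changed; `d`-generic.
-/

noncomputable section

open scoped ENNReal

/-! ### B⁰. The global (β′) target family by class pair and its column bound -/

namespace Literature.Probability.FitznerVanDerHofstad2017.NobleBlocks

open Literature.Probability.LatticeModels
open Literature.Probability.FitznerVanDerHofstad2017.BlockSummation

variable {d : ℕ}

section TargetsJ

variable (L : Letters d) (κ : Fin d × Bool)

/-- **The global target family, (β′) variant** by the CLASS PAIR `(α, β)` (`★ = Sum.inr`): regular/regular
`tgtRegB`, regular/`★` `tgtStarU`, `★`/regular `tgtStarL`, `★`/`★` `tgtStarLU`.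
[cite: FitznerVanDerHofstad2017, §5.1 (5.4) (arXiv:1506.07977v2 p. 48) and "Elements of the bounds" (p. 49); §6.1 (6.4) (p. 58); App. B (p. 76)] -/
def tgtJB : Fin 3 ⊕ Unit → Fin 3 ⊕ Unit → Site d → Site d → Site d → Site d → Site d → Site d → Bool × Fin 3 → ℝ≥0∞
  | Sum.inl a₀, Sum.inl a' => tgtRegB L κ a₀ a'
  | Sum.inl a₀, Sum.inr _ => tgtStarU L κ a₀
  | Sum.inr _, Sum.inl a' => tgtStarL L κ a'
  | Sum.inr _, Sum.inr _ => tgtStarLU L κ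

/-- [cite: FitznerVanDerHofstad2017, §5.1 (5.4) (arXiv:1506.07977v2 p. 48)] -/
@[simp] theorem tgtJB_inl_inl (a₀ a' : Fin 3) : tgtJB L κ (Sum.inl a₀) (Sum.inl a') = tgtRegB L κ a₀ a' := rfl

/-- [cite: FitznerVanDerHofstad2017, §5.1 (5.4) (arXiv:1506.07977v2 p. 48)] -/
@[simp] theorem tgtJB_inl_inr (a₀ : Fin 3) (s : Unit) : tgtJB L κ (Sum.inl a₀) (Sum.inr s) = tgtStarU L κ a₀ := rfl

/-- [cite: FitznerVanDerHofstad2017, §5.1 (5.4) (arXiv:1506.07977v2 p. 48)] -/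
@[simp] theorem tgtJB_inr_inl (s : Unit) (a' : Fin 3) : tgtJB L κ (Sum.inr s) (Sum.inl a') = tgtStarL L κ a' := rfl

/-- [cite: FitznerVanDerHofstad2017, §5.1 (5.4) (arXiv:1506.07977v2 p. 48)] -/
@[simp] theorem tgtJB_inr_inr (s s' : Unit) : tgtJB L κ (Sum.inr s) (Sum.inr s') = tgtStarLU L κ := rfl

/-- **The column bound of the (β′) global target family**: over any sub-family `P` of variants,
`Σ_{v ∈ P} tgtJB L κ α β (u,w,t,z,w′,u′) v ≤ secStarBpt (blockBFullptB' L X) 2 0 κ α β (u,w,t,z,w′,u′)`; the `★`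
entries of the section-choice family of `blockBFullptB'` are those of `blockBFullpt'`.
[cite: FitznerVanDerHofstad2017, §5.1 (5.4) (arXiv:1506.07977v2 p. 48) and "Elements of the bounds" (p. 49); §6.2.1 (6.49) (p. 65)] -/
theorem sum_filter_tgtJB_le (X : DirBlockFamilyPt d) (P : Bool × Fin 3 → Prop) [DecidablePred P] :
    ∀ (α β : Fin 3 ⊕ Unit) (u w t z w' u' : Site d),
      ∑ v ∈ Finset.univ.filter P, tgtJB L κ α β u w t z w' u' v ≤
        secStarBpt (blockBFullptB' L X) 2 0 κ α β u w t z w' u'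
  | Sum.inl a₀, Sum.inl a', u, w, t, z, w', u' => by
      rw [tgtJB_inl_inl, secStarBpt, starBpt_inl_inl]
      exact sum_filter_tgtRegB_le_blockBFullptB' L κ a₀ a' u w t z w' u' X P
  | Sum.inl a₀, Sum.inr s, u, w, t, z, w', u' => by
      rw [tgtJB_inl_inr, secStarBpt_blockBFullptB', starBpt_inl_inr]
      exact sum_filter_tgtStarU_le L κ a₀ u w t z w' u' X P
  | Sum.inr s, Sum.inl a', u, w, t, z, w', u' => by
      rw [tgtJB_inr_inl, secStarBpt_blockBFullptB', starBpt_inr_inl]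
      exact sum_filter_tgtStarL_le L κ a' u w t z w' u' X P
  | Sum.inr s, Sum.inr s', u, w, t, z, w', u' => by
      rw [tgtJB_inr_inr, secStarBpt_blockBFullptB', starBpt_inr_inr]
      exact sum_filter_tgtStarLU_le L κ u w t z w' u' X P

end TargetsJ

end Literature.Probability.FitznerVanDerHofstad2017.NobleBlocks

namespace Literature.Probability.FitznerVanDerHofstad2017

open Literature.Barriers.CriticalPhenomena Literature.Probability.Percolation
open Literature.Probability.LatticeModels Literature.Combinatorics.SimpleGraph _root_.SimpleGraph
open _root_.MeasureTheory
open Literature.Probability.FitznerVanDerHofstad2017.NobleBlocks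
open Literature.Probability.FitznerVanDerHofstad2017.NobleBlocks.LenIdx
open Literature.Probability.FitznerVanDerHofstad2017.BlockSummation

variable {d : ℕ}

/-! ### A. The (β′) dispatchers at a middle and at the first junction -/

section Dispatch

variable (p : unitInterval) (M : ℕ) (x : Site d) (b : Fin (M + 2) → Site d × Site d) (w t z : Fin (M + 2) → Site d)
  (a : Fin (M + 2) → Fin 3 ⊕ Unit) (c : Fin 3 ⊕ Unit) (τ : Fin (M + 1) → Bool × Fin 3)

/-- **`pkg` at a MIDDLE junction with regular class pair `(a₀, a′)`, (β′) targets**: a package with target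
`tgtRegB 𝐋 κ a₀ a′ (u_k, w_k, t_k, z_k, w_{k+1}, u_{k+1}) (τ i)` from the two coincidence slots `hR′` (`F‴` on the
corner `w_{k+1} = t_k`, `a′ ≠ 0`) and `hR` (`F″` cut-through with `z_k = t_k ∼ w_{k+1}`) of the landed dispatcher
(their `tgtReg` targets agree with `tgtRegB` there); the cell `((true, 2), 1, 2)` is the product-form package
`nonempty_jPkg_midE_K2B_lit` for `t_k ≠ u_{k+1}` and empty for `t_k = u_{k+1}` (`F′` with inner class `2`);
everything else is `NobleBoundsNDispatchReg.nonempty_jPkg_mid_reg`.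
[cite: FitznerVanDerHofstad2017, §6.1 (6.4) "Case a = 0 / a = 1 / a ≥ 2", "Case b = 0 / b = 1 / b ≥ 2" (arXiv:1506.07977v2 pp. 58–59); §5.1 (5.4) (p. 48); App. B Table "B^{(2),ι,a,b}" row a = 1, b ≥ 2 (p. 76)] -/
theorem nonempty_jPkg_mid_regB (i i₀ : Fin (M + 1)) (hk : i₀.succ = i.castSucc) (κ : Fin d × Bool)
    (hb : (b i.castSucc).2 = (b i.castSucc).1 + stepVec κ) (a₀ a' : Fin 3)
    (ha : a i.castSucc = Sum.inl a₀) (ha' : a i.succ = Sum.inl a')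
    (hR' : (τ i).1 = false → a' ≠ 0 → w i.succ = t i.castSucc →
      Nonempty (JPkg p (jctx M x b w t z a τ i.castSucc) (JFacts M x b w t z a c τ)
        (tgtReg (Letters.perc d p) κ a₀ a' (b i.castSucc).1 (w i.castSucc) (t i.castSucc) (z i.castSucc) (w i.succ)
          (b i.succ).1 (τ i))))
    (hR : τ i = (true, 0) → a' = 2 → t i.castSucc ≠ (b i.succ).1 → z i.castSucc = t i.castSucc →
      (zdGraph d).Adj (w i.succ) (t i.castSucc) →
      Nonempty (JPkg p (jctx M x b w t z a τ i.castSucc) (JFacts M x b w t z a c τ)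
        (tgtReg (Letters.perc d p) κ a₀ a' (b i.castSucc).1 (w i.castSucc) (t i.castSucc) (z i.castSucc) (w i.succ)
          (b i.succ).1 (τ i)))) :
    Nonempty (JPkg p (jctx M x b w t z a τ i.castSucc) (JFacts M x b w t z a c τ)
      (tgtRegB (Letters.perc d p) κ a₀ a' (b i.castSucc).1 (w i.castSucc) (t i.castSucc) (z i.castSucc) (w i.succ)
        (b i.succ).1 (τ i))) := by
  by_cases h : τ i = (true, 2) ∧ a₀ = 1 ∧ a' = 2
  · obtain ⟨hv, h1, h2⟩ := h
    subst h1 h2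
    have hσ : (τ i).1 = true := by rw [hv]
    have hc : (τ i).2 = 2 := by rw [hv]
    rw [hv, tgtRegB_K2]
    by_cases hty : t i.castSucc = (b i.succ).1
    · -- `F′` with inner class `2`: the piece is empty
      by_cases hzt : z i.castSucc = t i.castSucc
      · exact nonempty_jPkg_of_innerClass_ne_zero_eq p c _ i (by rw [hc]; decide) hzt.symm _
      · exact nonempty_jPkg_of_midE_t_eq_z_ne p M x b w t z a c τ _ i hσ ha' hty hzt _
    · exact nonempty_jPkg_midE_K2B_lit p M x b w t z a c τ i i₀ hk κ hb hσ hc ha ha' hty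
  · rw [tgtRegB_of_not _ _ _ _ _ _ _ _ _ _ h]
    exact nonempty_jPkg_mid_reg p M x b w t z a c τ i i₀ hk κ hb a₀ a' ha ha' hR' hR
      fun hv h1 h2 _ => (h ⟨hv, h1, h2⟩).elim

/-- **`pkg` at the FIRST junction with regular class pair `(a₀, a′)`, (β′) targets** behind the start letter
`P^{S,a₀}(u_0, w_0)`: slots `hR′`, `hR` as in `nonempty_jPkg_mid_regB`; the cell `((true, 2), 1, 2)` is
`nonempty_jPkg_firstE_K2B_lit`.
[cite: FitznerVanDerHofstad2017, §6.1 (6.4)–(6.10) "Case a = 0 / a = 1 / a ≥ 2", "Case b = 0 / b = 1 / b ≥ 2" (arXiv:1506.07977v2 pp. 58–59); §5.1 (5.4) (p. 48); App. B Table "B^{(2),ι,a,b}" row a = 1, b ≥ 2 (p. 76)] -/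
theorem nonempty_jPkg_first_regB (κ : Fin d × Bool)
    (hb : (b (0 : Fin (M + 1)).castSucc).2 = (b (0 : Fin (M + 1)).castSucc).1 + stepVec κ) (a₀ a' : Fin 3)
    (ha : a (0 : Fin (M + 1)).castSucc = Sum.inl a₀) (ha' : a (0 : Fin (M + 1)).succ = Sum.inl a')
    (hR' : (τ 0).1 = false → a' ≠ 0 → w (0 : Fin (M + 1)).succ = t (0 : Fin (M + 1)).castSucc →
      Nonempty (JPkg p (jctx M x b w t z a τ (0 : Fin (M + 1)).castSucc) (JFacts M x b w t z a c τ)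
        (blockPS (Letters.perc d p) a₀ (b (0 : Fin (M + 1)).castSucc).1 (w (0 : Fin (M + 1)).castSucc) *
          tgtReg (Letters.perc d p) κ a₀ a' (b (0 : Fin (M + 1)).castSucc).1 (w (0 : Fin (M + 1)).castSucc)
            (t (0 : Fin (M + 1)).castSucc) (z (0 : Fin (M + 1)).castSucc) (w (0 : Fin (M + 1)).succ)
            (b (0 : Fin (M + 1)).succ).1 (τ 0))))
    (hR : τ 0 = (true, 0) → a' = 2 → t (0 : Fin (M + 1)).castSucc ≠ (b (0 : Fin (M + 1)).succ).1 →
      z (0 : Fin (M + 1)).castSucc = t (0 : Fin (M + 1)).castSucc →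
      (zdGraph d).Adj (w (0 : Fin (M + 1)).succ) (t (0 : Fin (M + 1)).castSucc) →
      Nonempty (JPkg p (jctx M x b w t z a τ (0 : Fin (M + 1)).castSucc) (JFacts M x b w t z a c τ)
        (blockPS (Letters.perc d p) a₀ (b (0 : Fin (M + 1)).castSucc).1 (w (0 : Fin (M + 1)).castSucc) *
          tgtReg (Letters.perc d p) κ a₀ a' (b (0 : Fin (M + 1)).castSucc).1 (w (0 : Fin (M + 1)).castSucc)
            (t (0 : Fin (M + 1)).castSucc) (z (0 : Fin (M + 1)).castSucc) (w (0 : Fin (M + 1)).succ)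
            (b (0 : Fin (M + 1)).succ).1 (τ 0)))) :
    Nonempty (JPkg p (jctx M x b w t z a τ (0 : Fin (M + 1)).castSucc) (JFacts M x b w t z a c τ)
      (blockPS (Letters.perc d p) a₀ (b (0 : Fin (M + 1)).castSucc).1 (w (0 : Fin (M + 1)).castSucc) *
        tgtRegB (Letters.perc d p) κ a₀ a' (b (0 : Fin (M + 1)).castSucc).1 (w (0 : Fin (M + 1)).castSucc)
          (t (0 : Fin (M + 1)).castSucc) (z (0 : Fin (M + 1)).castSucc) (w (0 : Fin (M + 1)).succ)
          (b (0 : Fin (M + 1)).succ).1 (τ 0))) := by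
  by_cases h : τ 0 = (true, 2) ∧ a₀ = 1 ∧ a' = 2
  · obtain ⟨hv, h1, h2⟩ := h
    subst h1 h2
    have hσ : (τ 0).1 = true := by rw [hv]
    have hc : (τ 0).2 = 2 := by rw [hv]
    rw [hv, tgtRegB_K2]
    by_cases hty : t (0 : Fin (M + 1)).castSucc = (b (0 : Fin (M + 1)).succ).1
    · -- `F′` with inner class `2`: the piece is empty
      by_cases hzt : z (0 : Fin (M + 1)).castSucc = t (0 : Fin (M + 1)).castSucc
      · exact nonempty_jPkg_of_innerClass_ne_zero_eq p c _ 0 (by rw [hc]; decide) hzt.symm _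
      · exact nonempty_jPkg_of_midE_t_eq_z_ne p M x b w t z a c τ _ 0 hσ ha' hty hzt _
    · exact nonempty_jPkg_firstE_K2B_lit p M x b w t z a c τ κ hb hσ hc ha ha' hty
  · rw [tgtRegB_of_not _ _ _ _ _ _ _ _ _ _ h]
    exact nonempty_jPkg_first_reg p M x b w t z a c τ κ hb a₀ a' ha ha' hR' hR
      fun hv h1 h2 _ => (h ⟨hv, h1, h2⟩).elim

end Dispatch

/-! ### B. The per-junction (β′) targets and the consumer's `hT` -/

section Targets

variable (L : Letters d) (M : ℕ) (x : Site d) (a : Fin (M + 2) → Fin 3 ⊕ Unit) (c : Fin 3 ⊕ Unit)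
  (b : Fin (M + 2) → Site d × Site d) (w t z : Fin (M + 2) → Site d) (κ : Fin (M + 2) → Fin d × Bool)

/-- **The (β′) target family of the first/middle junction `i`** under direction vector `κ`: `tgtJB` at the class pair
`(a_i, a_{i+1})` and the parameters `(u_i, w_i, t_i, z_i, w_{i+1}, u_{i+1})`, with the start factor at `i = 0`.
[cite: FitznerVanDerHofstad2017, §6.1 (6.4) (arXiv:1506.07977v2 p. 58); §5.1 (5.4) (p. 48)] -/
def tgtAllB (i : Fin (M + 1)) (v : Bool × Fin 3) : ℝ≥0∞ :=
  (if i = 0 then starS (blockPS L) (a (0 : Fin (M + 1)).castSucc) (b (0 : Fin (M + 1)).castSucc).1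
      (w (0 : Fin (M + 1)).castSucc) else 1) *
    tgtJB L (κ i.castSucc) (a i.castSucc) (a i.succ) (b i.castSucc).1 (w i.castSucc) (t i.castSucc) (z i.castSucc)
      (w i.succ) (b i.succ).1 v

/-- **`hT`, (β′) variant**, for `S := starS (blockPS L)` and `Bpt := secStarBpt (blockBFullptB' L X) 2 0`.
[cite: FitznerVanDerHofstad2017, §5.1 (5.4) (arXiv:1506.07977v2 p. 48) and "Elements of the bounds" (p. 49); §6.1 (6.4) (p. 58)] -/
theorem sum_filter_tgtAllB_le (X : DirBlockFamilyPt d) (i : Fin (M + 1)) :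
    ∑ v ∈ Finset.univ.filter (AdmV M a i), tgtAllB L M a b w t z κ i v ≤
      (if i = 0 then starS (blockPS L) (a 0) (b 0).1 (w 0) else 1) *
        secStarBpt (blockBFullptB' L X) 2 0 (κ i.castSucc) (a i.castSucc) (a i.succ) (b i.castSucc).1 (w i.castSucc)
          (t i.castSucc) (z i.castSucc) (w i.succ) (b i.succ).1 := by
  unfold tgtAllB
  rw [← Finset.mul_sum]
  exact mul_le_mul' le_rfl (sum_filter_tgtJB_le L (κ i.castSucc) X (AdmV M a i) _ _ _ _ _ _ _ _)

end Targets

/-! ### C. `pkg` at every junction from per-pair packages, (β′) targets -/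

section Packages

variable (p : unitInterval) (M : ℕ) (x : Site d) (b : Fin (M + 2) → Site d × Site d) (w t z : Fin (M + 2) → Site d)
  (a : Fin (M + 2) → Fin 3 ⊕ Unit) (c : Fin 3 ⊕ Unit) (τ : Fin (M + 1) → Bool × Fin 3)

/-- **`pkg` from per-pair packages, (β′) targets**: `NobleBoundsNDispatchAll.nonempty_jPkg_all` with `tgtRegB` in the
two regular-pair families (`hFR`, `hMR`); the regular/`★`, `★★`, closed-first-level and last-junction cases are the
landed ones.
[cite: FitznerVanDerHofstad2017, §6.1 (6.4) and "Case b = 0 / 1 / ≥ 2" (arXiv:1506.07977v2 pp. 58–59); §5.1 (5.4) (p. 48); (4.57)–(4.64) (pp. 41–42)] -/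
theorem nonempty_jPkg_allB (κ : Fin (M + 2) → Fin d × Bool) (hκ : ∀ i, (b i).2 = (b i).1 + stepVec (κ i))
    (hτ : AdmT M a τ)
    (hFR : ∀ a₀ a' : Fin 3, a (0 : Fin (M + 1)).castSucc = Sum.inl a₀ → a (0 : Fin (M + 1)).succ = Sum.inl a' →
      Nonempty (JPkg p (jctx M x b w t z a τ (0 : Fin (M + 1)).castSucc) (JFacts M x b w t z a c τ)
        (blockPS (Letters.perc d p) a₀ (b (0 : Fin (M + 1)).castSucc).1 (w (0 : Fin (M + 1)).castSucc) *
          tgtRegB (Letters.perc d p) (κ (0 : Fin (M + 1)).castSucc) a₀ a' (b (0 : Fin (M + 1)).castSucc).1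
            (w (0 : Fin (M + 1)).castSucc) (t (0 : Fin (M + 1)).castSucc) (z (0 : Fin (M + 1)).castSucc)
            (w (0 : Fin (M + 1)).succ) (b (0 : Fin (M + 1)).succ).1 (τ 0))))
    (hMR : ∀ i i₀ : Fin (M + 1), i₀.succ = i.castSucc → ∀ a₀ a' : Fin 3, a i.castSucc = Sum.inl a₀ →
      a i.succ = Sum.inl a' →
      Nonempty (JPkg p (jctx M x b w t z a τ i.castSucc) (JFacts M x b w t z a c τ)
        (tgtRegB (Letters.perc d p) (κ i.castSucc) a₀ a' (b i.castSucc).1 (w i.castSucc) (t i.castSucc) (z i.castSucc)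
          (w i.succ) (b i.succ).1 (τ i))))
    (hML : ∀ i i₀ : Fin (M + 1), i₀.succ = i.castSucc → ∀ (u₀ : Unit) (a' : Fin 3), a i.castSucc = Sum.inr u₀ →
      a i.succ = Sum.inl a' →
      Nonempty (JPkg p (jctx M x b w t z a τ i.castSucc) (JFacts M x b w t z a c τ)
        (tgtStarL (Letters.perc d p) (κ i.castSucc) a' (b i.castSucc).1 (w i.castSucc) (t i.castSucc) (z i.castSucc)
          (w i.succ) (b i.succ).1 (τ i)))) :
    ∀ k, Nonempty (JPkg p (jctx M x b w t z a τ k) (JFacts M x b w t z a c τ)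
      (jTarget M (tgtAllB (Letters.perc d p) M a b w t z κ) (tgtLast (Letters.perc d p) M x a c b w t z κ) τ k)) := by
  intro k
  induction k using Fin.lastCases with
  | last =>
      simp only [jTarget, Fin.lastCases_last]
      exact nonempty_jPkg_end_starA p M x b w t z a c τ (κ _) (hκ _)
  | cast i =>
      simp only [jTarget, Fin.lastCases_castSucc]
      -- the kind bit of a level below a closed one is `false` (admissibility)
      have hσ : ∀ u₁ : Unit, a i.succ = Sum.inr u₁ → (τ i).1 = false := fun u₁ h => hτ i (by rw [h]; rfl)
      rcases Fin.eq_zero_or_eq_succ i with rfl | ⟨j, rfl⟩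
      · -- the FIRST junction
        rw [tgtAllB, if_pos rfl]
        rcases ha : a (0 : Fin (M + 1)).castSucc with a₀ | u₀
        · rcases ha' : a (0 : Fin (M + 1)).succ with a' | u₁
          · rw [starS_inl, tgtJB_inl_inl]
            exact hFR a₀ a' ha ha'
          · rw [starS_inl, tgtJB_inl_inr]
            exact nonempty_jPkg_first_starU p M x b w t z a c τ (κ _) (hκ _) a₀ ha ha' (hσ u₁ ha')
        · exact nonempty_jPkg_of_closed_zero p M x b w t z a c τ ha _ _
      · -- a MIDDLE junction `k = j + 1`
        rw [tgtAllB, if_neg (Fin.succ_ne_zero j), one_mul]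
        have hk : (j.castSucc).succ = (j.succ).castSucc := Fin.succ_castSucc j
        rcases ha : a j.succ.castSucc with a₀ | u₀
        · rcases ha' : a j.succ.succ with a' | u₁
          · rw [tgtJB_inl_inl]
            exact hMR _ _ hk a₀ a' ha ha'
          · rw [tgtJB_inl_inr]
            exact nonempty_jPkg_mid_starU p M x b w t z a c τ _ _ hk (κ _) (hκ _) a₀ ha ha' (hσ u₁ ha')
        · rcases ha' : a j.succ.succ with a' | u₁
          · rw [tgtJB_inr_inl]
            exact hML _ _ hk u₀ a' ha ha'
          · rw [tgtJB_inr_inr]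
            by_cases hs : z j.succ.castSucc = w j.succ.castSucc ∧ w j.succ.succ = (b j.succ.castSucc).1
            · exact nonempty_jPkg_mid_starStar p M x b w t z a c τ _ _ hk (κ _) (hκ _) ha ha' hs.1 hs.2
            · exact nonempty_jPkg_starStar_of_ne p M x b w t z a c τ _ _ hk ha ha' (not_and_or.mp hs) _

end Packages

/-! ### D. The class estimate `h2` over `secStarBpt (blockBFullptB' (Letters.perc d p) X) 2 0` from per-pair packages -/

section ClassEstimate

variable (p : unitInterval) (M : ℕ) (x : Site d)

/-- **THE CLASS ESTIMATE `h2` FROM PER-PAIR JUNCTION PACKAGES, (β′) targets**: at `(a, c, b⃗, w⃗, t⃗, z⃗)`, packages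
for the first regular pair and the middle regular pairs against `tgtRegB`, and for the middle lower-`★` pairs — for
every direction vector and admissible variant — give `(∏_i J(b_i)) · ℙ^{⊗(M+3)}(E ∩ C(a,c)) ≤ Σ_κ 𝟙{b = (u, u + e_κ)} ·
starS(P^S)^{a_0}(u_0,w_0) · chainTail (secStarBpt (blockBFullptB' 𝐋 X) 2 0) (starA Ā' (secEA Ā' 2)) (starS P^E)`.
[cite: FitznerVanDerHofstad2017, §6.1 (6.4) pp. 58–59, §6.2.1 (6.48)–(6.51) pp. 65–67, §5.1 (5.4) p. 48, App. B pp. 74–78 (arXiv:1506.07977v2)] -/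
theorem prod_bondJ_mul_piPerc_jwCover_le_secStarB_of_pairPackages (X : DirBlockFamilyPt d)
    (a : Fin (M + 2) → Fin 3 ⊕ Unit) (c : Fin 3 ⊕ Unit) (b : Fin (M + 2) → Site d × Site d)
    (w t z : Fin (M + 2) → Site d)
    (hFR : ∀ κ : Fin (M + 2) → Fin d × Bool, (∀ i, (b i).2 = (b i).1 + stepVec (κ i)) →
      ∀ τ : Fin (M + 1) → Bool × Fin 3, AdmT M a τ →
      ∀ a₀ a' : Fin 3, a (0 : Fin (M + 1)).castSucc = Sum.inl a₀ → a (0 : Fin (M + 1)).succ = Sum.inl a' →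
      Nonempty (JPkg p (jctx M x b w t z a τ (0 : Fin (M + 1)).castSucc) (JFacts M x b w t z a c τ)
        (blockPS (Letters.perc d p) a₀ (b (0 : Fin (M + 1)).castSucc).1 (w (0 : Fin (M + 1)).castSucc) *
          tgtRegB (Letters.perc d p) (κ (0 : Fin (M + 1)).castSucc) a₀ a' (b (0 : Fin (M + 1)).castSucc).1
            (w (0 : Fin (M + 1)).castSucc) (t (0 : Fin (M + 1)).castSucc) (z (0 : Fin (M + 1)).castSucc)
            (w (0 : Fin (M + 1)).succ) (b (0 : Fin (M + 1)).succ).1 (τ 0))))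
    (hMR : ∀ κ : Fin (M + 2) → Fin d × Bool, (∀ i, (b i).2 = (b i).1 + stepVec (κ i)) →
      ∀ τ : Fin (M + 1) → Bool × Fin 3, AdmT M a τ →
      ∀ i i₀ : Fin (M + 1), i₀.succ = i.castSucc → ∀ a₀ a' : Fin 3, a i.castSucc = Sum.inl a₀ →
      a i.succ = Sum.inl a' →
      Nonempty (JPkg p (jctx M x b w t z a τ i.castSucc) (JFacts M x b w t z a c τ)
        (tgtRegB (Letters.perc d p) (κ i.castSucc) a₀ a' (b i.castSucc).1 (w i.castSucc) (t i.castSucc) (z i.castSucc)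
          (w i.succ) (b i.succ).1 (τ i))))
    (hML : ∀ κ : Fin (M + 2) → Fin d × Bool, (∀ i, (b i).2 = (b i).1 + stepVec (κ i)) →
      ∀ τ : Fin (M + 1) → Bool × Fin 3, AdmT M a τ →
      ∀ i i₀ : Fin (M + 1), i₀.succ = i.castSucc → ∀ (u₀ : Unit) (a' : Fin 3), a i.castSucc = Sum.inr u₀ →
      a i.succ = Sum.inl a' →
      Nonempty (JPkg p (jctx M x b w t z a τ i.castSucc) (JFacts M x b w t z a c τ)
        (tgtStarL (Letters.perc d p) (κ i.castSucc) a' (b i.castSucc).1 (w i.castSucc) (t i.castSucc) (z i.castSucc)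
          (w i.succ) (b i.succ).1 (τ i)))) :
    (∏ i, ENNReal.ofReal (bondJ d p ((b i).2 - (b i).1))) *
        piPerc d p (M + 3) (jwCoverE M x b w t z ∩ jwCoverC M x b w t z a c) ≤
      ∑ κ : Fin (M + 2) → Fin d × Bool, dirInd stepVec κ b *
        (starS (blockPS (Letters.perc d p)) (a 0) (b 0).1 (w 0) *
          chainTail (secStarBpt (blockBFullptB' (Letters.perc d p) X) 2 0)
            (starA (blockAbar' (Letters.perc d p)) (secEA (blockAbar' (Letters.perc d p)) 2))
            (starS (blockPE (Letters.perc d p))) x (M + 1) κ a c b w t z) :=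
  prod_bondJ_mul_piPerc_jwCover_le_chain_of_packages p M x (starS (blockPS (Letters.perc d p)))
    (secStarBpt (blockBFullptB' (Letters.perc d p) X) 2 0)
    (starA (blockAbar' (Letters.perc d p)) (secEA (blockAbar' (Letters.perc d p)) 2)) (starS (blockPE (Letters.perc d p)))
    a c b w t z (tgtAllB (Letters.perc d p) M a b w t z) (tgtLast (Letters.perc d p) M x a c b w t z)
    (fun κ hκ τ hτ => nonempty_jPkg_allB p M x b w t z a c τ κ hκ hτ (hFR κ hκ τ hτ) (hMR κ hκ τ hτ) (hML κ hκ τ hτ))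
    (fun κ _ i => sum_filter_tgtAllB_le (Letters.perc d p) M a b w t z κ X i) fun _ _ => le_rfl

end ClassEstimate

/-! ### E. (5.34) against the (β′) block: from a cover, and at `N = M + 2` from per-pair packages -/

section SizeModel

open scoped Matrix

variable (p : unitInterval)

/-- **(5.34) at `N = n + 1` over `Fin 3 ⊕ Unit` under the section choice, (β′) block**: from a finite cover
`(E, C)` of the bounding events with `h1` and pointwise class estimates `h2` against
`secStarBpt (blockBFullptB' 𝐋 X) 2 0` and `starA (blockAbar' 𝐋) (secEA (blockAbar' 𝐋) 2)`, for every four-line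
remainder family `X` summing to a translation-invariant `X₂`, the printed-norm bound with the regular block
`starB (blockBFullB' 𝐋 X₂) (secEc (blockBFullpt' 𝐋 X) 0) (secEo (blockBFullpt' 𝐋 X) 2) (secEoc (blockBFullpt' 𝐋 X) 2 0)`
(the `★` families of the (β′) block are the landed ones).  The (β′) copy of
`NobleBoundsNCoverPrime.tsum_nobleXiT_le_secStar'_of_cover`, over `NobleBoundsNCover.nobleXiT_le_recP_chain_of_cover`.
[cite: FitznerVanDerHofstad2017, Prop. 5.5 (5.34) (arXiv:1506.07977v2 p. 53); §5.1 (5.4), "Elements of the bounds" (pp. 48–49); Lemma 6.1 and §6.2.1 (6.48)–(6.51) (pp. 65–67); §6.1 (6.4)–(6.5) (p. 58)] -/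
theorem tsum_nobleXiT_le_secStarB'_of_cover (n : ℕ)
    (X : DirBlockFamilyPt d) (X₂ : DirBlockFamily d)
    (hXsum : ∀ κ a a' u w w' u', ∑' t, ∑' z, X κ a a' u w t z w' u' = X₂ κ a a' u w w' u')
    (hX₂ti : ∀ ι a b, IsTransInv (X₂ ι a b))
    (hXti : ∀ κ a a', IsTransInv₆ (X κ a a'))
    (E : Site d → (Fin (n + 1) → Site d × Site d) → (Fin (n + 1) → Site d) → (Fin (n + 1) → Site d) →
      (Fin (n + 1) → Site d) → Set (Fin (n + 2) → BondConfig (Site d)))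
    (C : Site d → (Fin (n + 1) → Site d × Site d) → (Fin (n + 1) → Site d) → (Fin (n + 1) → Site d) →
      (Fin (n + 1) → Site d) → (Fin (n + 1) → Fin 3 ⊕ Unit) → Fin 3 ⊕ Unit → Set (Fin (n + 2) → BondConfig (Site d)))
    (hC : ∀ x b w t z, E x b w t z ⊆ ⋃ a, ⋃ c, C x b w t z a c)
    (h1 : ∀ x, nobleXiT d p (n + 1) x ≤ ∑' b : Fin (n + 1) → Site d × Site d, ∑' w : Fin (n + 1) → Site d,
      ∑' t : Fin (n + 1) → Site d, ∑' z : Fin (n + 1) → Site d,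
        (∏ i, ENNReal.ofReal (bondJ d p ((b i).2 - (b i).1))) * piPerc d p (n + 2) (E x b w t z))
    (h2 : ∀ x (a : Fin (n + 1) → Fin 3 ⊕ Unit) (c : Fin 3 ⊕ Unit) (b : Fin (n + 1) → Site d × Site d)
      (w t z : Fin (n + 1) → Site d),
      (∏ i, ENNReal.ofReal (bondJ d p ((b i).2 - (b i).1))) * piPerc d p (n + 2) (E x b w t z ∩ C x b w t z a c) ≤
        ∑ κ : Fin (n + 1) → Fin d × Bool, dirInd stepVec κ b *
          (starS (blockPS (Letters.perc d p)) (a 0) (b 0).1 (w 0) *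
            chainTail (secStarBpt (blockBFullptB' (Letters.perc d p) X) 2 0)
              (starA (blockAbar' (Letters.perc d p)) (secEA (blockAbar' (Letters.perc d p)) 2))
              (starS (blockPE (Letters.perc d p))) x n κ a c b w t z)) :
    ∑' x, nobleXiT d p (n + 1) x ≤
      vecP (starS (blockPS (Letters.perc d p))) ᵥ*
        matB (starB (blockBFullB' (Letters.perc d p) X₂) (secEc (blockBFullpt' (Letters.perc d p) X) 0)
          (secEo (blockBFullpt' (Letters.perc d p) X) 2) (secEoc (blockBFullpt' (Letters.perc d p) X) 2 0)) ^ n ᵥ*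
          matAbar (starA (blockAbar' (Letters.perc d p)) (secEA (blockAbar' (Letters.perc d p)) 2)) ⬝ᵥ
        vecP (starS (blockPE (Letters.perc d p))) :=
  tsum_le_vecMul_pow_dotProduct'
    (isTransInv_starB (isTransInv_blockBFullB' (Letters.perc d p) hX₂ti)
      (isTransInv₃_secEc (isTransInv₆_blockBFullpt' (Letters.perc d p) hXti) 0)
      (isTransInv_secEo (isTransInv₆_blockBFullpt' (Letters.perc d p) hXti) 2)
      (isTransInv₃_secEoc (isTransInv₆_blockBFullpt' (Letters.perc d p) hXti) 2 0))
    (isTransInv_starA (isTransInv_blockAbar' (Letters.perc d p)) (isTransInv₃_secEA (isTransInv_blockAbar' (Letters.perc d p)) 2))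
    (fun x => nobleXiT d p (n + 1) x) (starS (blockPS (Letters.perc d p))) (starS (blockPE (Letters.perc d p))) n
    fun x =>
    nobleXiT_le_recP_chain_of_cover p x n (starS (blockPS (Letters.perc d p)))
      (starB (blockBFullB' (Letters.perc d p) X₂) (secEc (blockBFullpt' (Letters.perc d p) X) 0)
        (secEo (blockBFullpt' (Letters.perc d p) X) 2) (secEoc (blockBFullpt' (Letters.perc d p) X) 2 0))
      (secStarBpt (blockBFullptB' (Letters.perc d p) X) 2 0)
      (secStarBpt_blockBFullptB'_hBpt (Letters.perc d p) X X₂ hXsum)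
      (starA (blockAbar' (Letters.perc d p)) (secEA (blockAbar' (Letters.perc d p)) 2)) (starS (blockPE (Letters.perc d p)))
      (E x) (C x) (hC x) (h1 x) (h2 x)

variable (M : ℕ)

/-- **(5.34) AT `N = M + 2` FROM PER-PAIR JUNCTION PACKAGES, (β′) targets** (section choice, the cover of
`NobleJointNLevel`): if at every `(x, a, c, b⃗, w⃗, t⃗, z⃗)` the three per-pair package families of
`prod_bondJ_mul_piPerc_jwCover_le_secStarB_of_pairPackages` are available, then for every four-line remainder family
`X` summing to a translation-invariant `X₂`,
`Σ_x Ξ̂^{(M+2)}(x) ≤ (P^S)ᵗ · B_sec^{M+1} · Ā_sec · P^E` over `Fin 3 ⊕ Unit` with the regular block `blockBFullB' 𝐋 X₂`.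
[cite: FitznerVanDerHofstad2017, Prop. 5.5 (5.34) (arXiv:1506.07977v2 p. 53); §5.1 (5.4) (p. 48) and "Elements of the bounds" (p. 49); §6.1 (6.4) (pp. 58–59); Lemma 6.1, §6.2.1 (6.48)–(6.51) (pp. 65–67)] -/
theorem tsum_nobleXiT_le_secStarB'_of_pairPackages (X : DirBlockFamilyPt d) (X₂ : DirBlockFamily d)
    (hXsum : ∀ κ a a' u w w' u', ∑' t, ∑' z, X κ a a' u w t z w' u' = X₂ κ a a' u w w' u')
    (hX₂ti : ∀ ι a b, IsTransInv (X₂ ι a b)) (hXti : ∀ κ a a', IsTransInv₆ (X κ a a'))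
    (hFR : ∀ (x : Site d) (a : Fin (M + 2) → Fin 3 ⊕ Unit) (c : Fin 3 ⊕ Unit) (b : Fin (M + 2) → Site d × Site d)
      (w t z : Fin (M + 2) → Site d),
      ∀ κ : Fin (M + 2) → Fin d × Bool, (∀ i, (b i).2 = (b i).1 + stepVec (κ i)) →
      ∀ τ : Fin (M + 1) → Bool × Fin 3, AdmT M a τ →
      ∀ a₀ a' : Fin 3, a (0 : Fin (M + 1)).castSucc = Sum.inl a₀ → a (0 : Fin (M + 1)).succ = Sum.inl a' →
      Nonempty (JPkg p (jctx M x b w t z a τ (0 : Fin (M + 1)).castSucc) (JFacts M x b w t z a c τ)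
        (blockPS (Letters.perc d p) a₀ (b (0 : Fin (M + 1)).castSucc).1 (w (0 : Fin (M + 1)).castSucc) *
          tgtRegB (Letters.perc d p) (κ (0 : Fin (M + 1)).castSucc) a₀ a' (b (0 : Fin (M + 1)).castSucc).1
            (w (0 : Fin (M + 1)).castSucc) (t (0 : Fin (M + 1)).castSucc) (z (0 : Fin (M + 1)).castSucc)
            (w (0 : Fin (M + 1)).succ) (b (0 : Fin (M + 1)).succ).1 (τ 0))))
    (hMR : ∀ (x : Site d) (a : Fin (M + 2) → Fin 3 ⊕ Unit) (c : Fin 3 ⊕ Unit) (b : Fin (M + 2) → Site d × Site d)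
      (w t z : Fin (M + 2) → Site d),
      ∀ κ : Fin (M + 2) → Fin d × Bool, (∀ i, (b i).2 = (b i).1 + stepVec (κ i)) →
      ∀ τ : Fin (M + 1) → Bool × Fin 3, AdmT M a τ →
      ∀ i i₀ : Fin (M + 1), i₀.succ = i.castSucc → ∀ a₀ a' : Fin 3, a i.castSucc = Sum.inl a₀ →
      a i.succ = Sum.inl a' →
      Nonempty (JPkg p (jctx M x b w t z a τ i.castSucc) (JFacts M x b w t z a c τ)
        (tgtRegB (Letters.perc d p) (κ i.castSucc) a₀ a' (b i.castSucc).1 (w i.castSucc) (t i.castSucc) (z i.castSucc)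
          (w i.succ) (b i.succ).1 (τ i))))
    (hML : ∀ (x : Site d) (a : Fin (M + 2) → Fin 3 ⊕ Unit) (c : Fin 3 ⊕ Unit) (b : Fin (M + 2) → Site d × Site d)
      (w t z : Fin (M + 2) → Site d),
      ∀ κ : Fin (M + 2) → Fin d × Bool, (∀ i, (b i).2 = (b i).1 + stepVec (κ i)) →
      ∀ τ : Fin (M + 1) → Bool × Fin 3, AdmT M a τ →
      ∀ i i₀ : Fin (M + 1), i₀.succ = i.castSucc → ∀ (u₀ : Unit) (a' : Fin 3), a i.castSucc = Sum.inr u₀ →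
      a i.succ = Sum.inl a' →
      Nonempty (JPkg p (jctx M x b w t z a τ i.castSucc) (JFacts M x b w t z a c τ)
        (tgtStarL (Letters.perc d p) (κ i.castSucc) a' (b i.castSucc).1 (w i.castSucc) (t i.castSucc) (z i.castSucc)
          (w i.succ) (b i.succ).1 (τ i)))) :
    ∑' x, nobleXiT d p (M + 2) x ≤
      vecP (starS (blockPS (Letters.perc d p))) ᵥ*
        matB (starB (blockBFullB' (Letters.perc d p) X₂) (secEc (blockBFullpt' (Letters.perc d p) X) 0)
          (secEo (blockBFullpt' (Letters.perc d p) X) 2) (secEoc (blockBFullpt' (Letters.perc d p) X) 2 0)) ^ (M + 1) ᵥ*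
          matAbar (starA (blockAbar' (Letters.perc d p)) (secEA (blockAbar' (Letters.perc d p)) 2)) ⬝ᵥ
        vecP (starS (blockPE (Letters.perc d p))) :=
  tsum_nobleXiT_le_secStarB'_of_cover p (M + 1) X X₂ hXsum hX₂ti hXti (fun x b w t z => jwCoverE M x b w t z)
    (fun x b w t z a c => jwCoverC M x b w t z a c) (fun x => jwCoverE_subset_iUnion_jwCoverC M x)
    (fun x => nobleXiT_succ_succ_le_jwCoverE p M x)
    fun x a c b w t z => prod_bondJ_mul_piPerc_jwCover_le_secStarB_of_pairPackages p M x X a c b w t z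
      (hFR x a c b w t z) (hMR x a c b w t z) (hML x a c b w t z)

end SizeModel

/-! ### F. `pkg` and (5.34) at `N = M + 2` from the six coincidence slots -/

section Residual

open scoped Matrix

variable (p : unitInterval) (M : ℕ)

section Pkg

variable (x : Site d) (b : Fin (M + 2) → Site d × Site d) (w t z : Fin (M + 2) → Site d)
  (a : Fin (M + 2) → Fin 3 ⊕ Unit) (c : Fin 3 ⊕ Unit) (τ : Fin (M + 1) → Bool × Fin 3)

/-- **`pkg` AT EVERY JUNCTION FROM THE SIX COINCIDENCE SLOTS, (β′) targets**: `nonempty_jPkg_allB` with its three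
per-pair families supplied by `nonempty_jPkg_first_regB`, `nonempty_jPkg_mid_regB` (§A) and the landed
`NobleBoundsNLowE.nonempty_jPkg_mid_starL'`.  What remains: R′ / R at the first pair (`hR'₀`, `hR₀`), at the middle
regular pairs (`hR'`, `hR`), and over a closed lower level at the middle lower-`★` pairs (`hR'L`, `hRL`).
[cite: FitznerVanDerHofstad2017, §6.1 (6.4), "Case b = 0 / 1 / ≥ 2" and the coincidence cases `w' = t`, `z = t` (arXiv:1506.07977v2 pp. 58–59); App. B (pp. 75–76); §5.1 (5.4) (p. 48)] -/
theorem nonempty_jPkg_all_of_residualsB (κ : Fin (M + 2) → Fin d × Bool) (hκ : ∀ i, (b i).2 = (b i).1 + stepVec (κ i))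
    (hτ : AdmT M a τ)
    (hR'₀ : ∀ a₀ a' : Fin 3, a (0 : Fin (M + 1)).castSucc = Sum.inl a₀ → a (0 : Fin (M + 1)).succ = Sum.inl a' →
      (τ 0).1 = false → a' ≠ 0 → w (0 : Fin (M + 1)).succ = t (0 : Fin (M + 1)).castSucc →
      Nonempty (JPkg p (jctx M x b w t z a τ (0 : Fin (M + 1)).castSucc) (JFacts M x b w t z a c τ)
        (blockPS (Letters.perc d p) a₀ (b (0 : Fin (M + 1)).castSucc).1 (w (0 : Fin (M + 1)).castSucc) *
          tgtReg (Letters.perc d p) (κ (0 : Fin (M + 1)).castSucc) a₀ a' (b (0 : Fin (M + 1)).castSucc).1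
            (w (0 : Fin (M + 1)).castSucc) (t (0 : Fin (M + 1)).castSucc) (z (0 : Fin (M + 1)).castSucc)
            (w (0 : Fin (M + 1)).succ) (b (0 : Fin (M + 1)).succ).1 (τ 0))))
    (hR₀ : ∀ a₀ a' : Fin 3, a (0 : Fin (M + 1)).castSucc = Sum.inl a₀ → a (0 : Fin (M + 1)).succ = Sum.inl a' →
      τ 0 = (true, 0) → a' = 2 → t (0 : Fin (M + 1)).castSucc ≠ (b (0 : Fin (M + 1)).succ).1 →
      z (0 : Fin (M + 1)).castSucc = t (0 : Fin (M + 1)).castSucc →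
      (zdGraph d).Adj (w (0 : Fin (M + 1)).succ) (t (0 : Fin (M + 1)).castSucc) →
      Nonempty (JPkg p (jctx M x b w t z a τ (0 : Fin (M + 1)).castSucc) (JFacts M x b w t z a c τ)
        (blockPS (Letters.perc d p) a₀ (b (0 : Fin (M + 1)).castSucc).1 (w (0 : Fin (M + 1)).castSucc) *
          tgtReg (Letters.perc d p) (κ (0 : Fin (M + 1)).castSucc) a₀ a' (b (0 : Fin (M + 1)).castSucc).1
            (w (0 : Fin (M + 1)).castSucc) (t (0 : Fin (M + 1)).castSucc) (z (0 : Fin (M + 1)).castSucc)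
            (w (0 : Fin (M + 1)).succ) (b (0 : Fin (M + 1)).succ).1 (τ 0))))
    (hR' : ∀ i i₀ : Fin (M + 1), i₀.succ = i.castSucc → ∀ a₀ a' : Fin 3, a i.castSucc = Sum.inl a₀ →
      a i.succ = Sum.inl a' → (τ i).1 = false → a' ≠ 0 → w i.succ = t i.castSucc →
      Nonempty (JPkg p (jctx M x b w t z a τ i.castSucc) (JFacts M x b w t z a c τ)
        (tgtReg (Letters.perc d p) (κ i.castSucc) a₀ a' (b i.castSucc).1 (w i.castSucc) (t i.castSucc) (z i.castSucc)
          (w i.succ) (b i.succ).1 (τ i))))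
    (hR : ∀ i i₀ : Fin (M + 1), i₀.succ = i.castSucc → ∀ a₀ a' : Fin 3, a i.castSucc = Sum.inl a₀ →
      a i.succ = Sum.inl a' → τ i = (true, 0) → a' = 2 → t i.castSucc ≠ (b i.succ).1 →
      z i.castSucc = t i.castSucc → (zdGraph d).Adj (w i.succ) (t i.castSucc) →
      Nonempty (JPkg p (jctx M x b w t z a τ i.castSucc) (JFacts M x b w t z a c τ)
        (tgtReg (Letters.perc d p) (κ i.castSucc) a₀ a' (b i.castSucc).1 (w i.castSucc) (t i.castSucc) (z i.castSucc)
          (w i.succ) (b i.succ).1 (τ i))))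
    (hR'L : ∀ i i₀ : Fin (M + 1), i₀.succ = i.castSucc → ∀ (u₀ : Unit) (a' : Fin 3), a i.castSucc = Sum.inr u₀ →
      a i.succ = Sum.inl a' → (τ i).1 = false → a' ≠ 0 → w i.succ = t i.castSucc →
      Nonempty (JPkg p (jctx M x b w t z a τ i.castSucc) (JFacts M x b w t z a c τ)
        (tgtStarL (Letters.perc d p) (κ i.castSucc) a' (b i.castSucc).1 (w i.castSucc) (t i.castSucc) (z i.castSucc)
          (w i.succ) (b i.succ).1 (τ i))))
    (hRL : ∀ i i₀ : Fin (M + 1), i₀.succ = i.castSucc → ∀ (u₀ : Unit) (a' : Fin 3), a i.castSucc = Sum.inr u₀ →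
      a i.succ = Sum.inl a' → (τ i).1 = true → (τ i).2 = 0 → a' = 2 → t i.castSucc ≠ (b i.succ).1 →
      z i.castSucc = t i.castSucc → z i.castSucc = w i.castSucc → (zdGraph d).Adj (w i.succ) (t i.castSucc) →
      Nonempty (JPkg p (jctx M x b w t z a τ i.castSucc) (JFacts M x b w t z a c τ)
        (tgtStarL (Letters.perc d p) (κ i.castSucc) a' (b i.castSucc).1 (w i.castSucc) (t i.castSucc) (z i.castSucc)
          (w i.succ) (b i.succ).1 (τ i)))) :
    ∀ k, Nonempty (JPkg p (jctx M x b w t z a τ k) (JFacts M x b w t z a c τ)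
      (jTarget M (tgtAllB (Letters.perc d p) M a b w t z κ) (tgtLast (Letters.perc d p) M x a c b w t z κ) τ k)) :=
  nonempty_jPkg_allB p M x b w t z a c τ κ hκ hτ
    (fun a₀ a' ha ha' => nonempty_jPkg_first_regB p M x b w t z a c τ (κ _) (hκ _) a₀ a' ha ha'
      (hR'₀ a₀ a' ha ha') (hR₀ a₀ a' ha ha'))
    (fun i i₀ hk a₀ a' ha ha' => nonempty_jPkg_mid_regB p M x b w t z a c τ i i₀ hk (κ _) (hκ _) a₀ a' ha ha'
      (hR' i i₀ hk a₀ a' ha ha') (hR i i₀ hk a₀ a' ha ha'))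
    fun i i₀ hk u₀ a' ha ha' => nonempty_jPkg_mid_starL' p M x b w t z a c τ i i₀ hk (κ _) (hκ _) ha a' ha'
      (hR'L i i₀ hk u₀ a' ha ha') (hRL i i₀ hk u₀ a' ha ha')

end Pkg

/-- **(5.34) AT `N = M + 2` MODULO THE SIX COINCIDENCE SLOTS, (β′) block** (section choice): for every four-line
remainder family `X` summing to a translation-invariant `X₂`,
`Σ_x Ξ̂^{(M+2)}(x) ≤ (P^S)ᵗ · B_sec^{M+1} · Ā_sec · P^E` over `Fin 3 ⊕ Unit` with the regular block
`starB (blockBFullB' 𝐋 X₂) (secEc (blockBFullpt' 𝐋 X) 0) (secEo (blockBFullpt' 𝐋 X) 2) (secEoc (blockBFullpt' 𝐋 X) 2 0)`,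
granted the six coincidence slots of `nonempty_jPkg_all_of_residualsB` at every `(x, a, c, b⃗, w⃗, t⃗, z⃗)`, every
direction assignment `κ` of the pivotal bonds and every admissible junction-type assignment `τ`.
[cite: FitznerVanDerHofstad2017, Prop. 5.5 (5.34) (arXiv:1506.07977v2 p. 53); §5.1 (5.4) (p. 48) and "Elements of the bounds" (p. 49); §6.1 (6.4) (pp. 58–59); Lemma 6.1, §6.2.1 (6.48)–(6.51) (pp. 65–67); App. B Table "B^{(2),ι,a,b}" row a = 1, b ≥ 2 (p. 76)] -/
theorem tsum_nobleXiT_le_secStarB'_of_residuals (X : DirBlockFamilyPt d) (X₂ : DirBlockFamily d)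
    (hXsum : ∀ κ a a' u w w' u', ∑' t, ∑' z, X κ a a' u w t z w' u' = X₂ κ a a' u w w' u')
    (hX₂ti : ∀ ι a b, IsTransInv (X₂ ι a b)) (hXti : ∀ κ a a', IsTransInv₆ (X κ a a'))
    (hR'₀ : ∀ (x : Site d) (a : Fin (M + 2) → Fin 3 ⊕ Unit) (c : Fin 3 ⊕ Unit) (b : Fin (M + 2) → Site d × Site d)
      (w t z : Fin (M + 2) → Site d),
      ∀ κ : Fin (M + 2) → Fin d × Bool, (∀ i, (b i).2 = (b i).1 + stepVec (κ i)) →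
      ∀ τ : Fin (M + 1) → Bool × Fin 3, AdmT M a τ →
      ∀ a₀ a' : Fin 3, a (0 : Fin (M + 1)).castSucc = Sum.inl a₀ → a (0 : Fin (M + 1)).succ = Sum.inl a' →
      (τ 0).1 = false → a' ≠ 0 → w (0 : Fin (M + 1)).succ = t (0 : Fin (M + 1)).castSucc →
      Nonempty (JPkg p (jctx M x b w t z a τ (0 : Fin (M + 1)).castSucc) (JFacts M x b w t z a c τ)
        (blockPS (Letters.perc d p) a₀ (b (0 : Fin (M + 1)).castSucc).1 (w (0 : Fin (M + 1)).castSucc) *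
          tgtReg (Letters.perc d p) (κ (0 : Fin (M + 1)).castSucc) a₀ a' (b (0 : Fin (M + 1)).castSucc).1
            (w (0 : Fin (M + 1)).castSucc) (t (0 : Fin (M + 1)).castSucc) (z (0 : Fin (M + 1)).castSucc)
            (w (0 : Fin (M + 1)).succ) (b (0 : Fin (M + 1)).succ).1 (τ 0))))
    (hR₀ : ∀ (x : Site d) (a : Fin (M + 2) → Fin 3 ⊕ Unit) (c : Fin 3 ⊕ Unit) (b : Fin (M + 2) → Site d × Site d)
      (w t z : Fin (M + 2) → Site d),
      ∀ κ : Fin (M + 2) → Fin d × Bool, (∀ i, (b i).2 = (b i).1 + stepVec (κ i)) →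
      ∀ τ : Fin (M + 1) → Bool × Fin 3, AdmT M a τ →
      ∀ a₀ a' : Fin 3, a (0 : Fin (M + 1)).castSucc = Sum.inl a₀ → a (0 : Fin (M + 1)).succ = Sum.inl a' →
      τ 0 = (true, 0) → a' = 2 → t (0 : Fin (M + 1)).castSucc ≠ (b (0 : Fin (M + 1)).succ).1 →
      z (0 : Fin (M + 1)).castSucc = t (0 : Fin (M + 1)).castSucc →
      (zdGraph d).Adj (w (0 : Fin (M + 1)).succ) (t (0 : Fin (M + 1)).castSucc) →
      Nonempty (JPkg p (jctx M x b w t z a τ (0 : Fin (M + 1)).castSucc) (JFacts M x b w t z a c τ)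
        (blockPS (Letters.perc d p) a₀ (b (0 : Fin (M + 1)).castSucc).1 (w (0 : Fin (M + 1)).castSucc) *
          tgtReg (Letters.perc d p) (κ (0 : Fin (M + 1)).castSucc) a₀ a' (b (0 : Fin (M + 1)).castSucc).1
            (w (0 : Fin (M + 1)).castSucc) (t (0 : Fin (M + 1)).castSucc) (z (0 : Fin (M + 1)).castSucc)
            (w (0 : Fin (M + 1)).succ) (b (0 : Fin (M + 1)).succ).1 (τ 0))))
    (hR' : ∀ (x : Site d) (a : Fin (M + 2) → Fin 3 ⊕ Unit) (c : Fin 3 ⊕ Unit) (b : Fin (M + 2) → Site d × Site d)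
      (w t z : Fin (M + 2) → Site d),
      ∀ κ : Fin (M + 2) → Fin d × Bool, (∀ i, (b i).2 = (b i).1 + stepVec (κ i)) →
      ∀ τ : Fin (M + 1) → Bool × Fin 3, AdmT M a τ →
      ∀ i i₀ : Fin (M + 1), i₀.succ = i.castSucc → ∀ a₀ a' : Fin 3, a i.castSucc = Sum.inl a₀ →
      a i.succ = Sum.inl a' → (τ i).1 = false → a' ≠ 0 → w i.succ = t i.castSucc →
      Nonempty (JPkg p (jctx M x b w t z a τ i.castSucc) (JFacts M x b w t z a c τ)
        (tgtReg (Letters.perc d p) (κ i.castSucc) a₀ a' (b i.castSucc).1 (w i.castSucc) (t i.castSucc) (z i.castSucc)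
          (w i.succ) (b i.succ).1 (τ i))))
    (hR : ∀ (x : Site d) (a : Fin (M + 2) → Fin 3 ⊕ Unit) (c : Fin 3 ⊕ Unit) (b : Fin (M + 2) → Site d × Site d)
      (w t z : Fin (M + 2) → Site d),
      ∀ κ : Fin (M + 2) → Fin d × Bool, (∀ i, (b i).2 = (b i).1 + stepVec (κ i)) →
      ∀ τ : Fin (M + 1) → Bool × Fin 3, AdmT M a τ →
      ∀ i i₀ : Fin (M + 1), i₀.succ = i.castSucc → ∀ a₀ a' : Fin 3, a i.castSucc = Sum.inl a₀ →
      a i.succ = Sum.inl a' → τ i = (true, 0) → a' = 2 → t i.castSucc ≠ (b i.succ).1 →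
      z i.castSucc = t i.castSucc → (zdGraph d).Adj (w i.succ) (t i.castSucc) →
      Nonempty (JPkg p (jctx M x b w t z a τ i.castSucc) (JFacts M x b w t z a c τ)
        (tgtReg (Letters.perc d p) (κ i.castSucc) a₀ a' (b i.castSucc).1 (w i.castSucc) (t i.castSucc) (z i.castSucc)
          (w i.succ) (b i.succ).1 (τ i))))
    (hR'L : ∀ (x : Site d) (a : Fin (M + 2) → Fin 3 ⊕ Unit) (c : Fin 3 ⊕ Unit) (b : Fin (M + 2) → Site d × Site d)
      (w t z : Fin (M + 2) → Site d),
      ∀ κ : Fin (M + 2) → Fin d × Bool, (∀ i, (b i).2 = (b i).1 + stepVec (κ i)) →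
      ∀ τ : Fin (M + 1) → Bool × Fin 3, AdmT M a τ →
      ∀ i i₀ : Fin (M + 1), i₀.succ = i.castSucc → ∀ (u₀ : Unit) (a' : Fin 3), a i.castSucc = Sum.inr u₀ →
      a i.succ = Sum.inl a' → (τ i).1 = false → a' ≠ 0 → w i.succ = t i.castSucc →
      Nonempty (JPkg p (jctx M x b w t z a τ i.castSucc) (JFacts M x b w t z a c τ)
        (tgtStarL (Letters.perc d p) (κ i.castSucc) a' (b i.castSucc).1 (w i.castSucc) (t i.castSucc) (z i.castSucc)
          (w i.succ) (b i.succ).1 (τ i))))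
    (hRL : ∀ (x : Site d) (a : Fin (M + 2) → Fin 3 ⊕ Unit) (c : Fin 3 ⊕ Unit) (b : Fin (M + 2) → Site d × Site d)
      (w t z : Fin (M + 2) → Site d),
      ∀ κ : Fin (M + 2) → Fin d × Bool, (∀ i, (b i).2 = (b i).1 + stepVec (κ i)) →
      ∀ τ : Fin (M + 1) → Bool × Fin 3, AdmT M a τ →
      ∀ i i₀ : Fin (M + 1), i₀.succ = i.castSucc → ∀ (u₀ : Unit) (a' : Fin 3), a i.castSucc = Sum.inr u₀ →
      a i.succ = Sum.inl a' → (τ i).1 = true → (τ i).2 = 0 → a' = 2 → t i.castSucc ≠ (b i.succ).1 →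
      z i.castSucc = t i.castSucc → z i.castSucc = w i.castSucc → (zdGraph d).Adj (w i.succ) (t i.castSucc) →
      Nonempty (JPkg p (jctx M x b w t z a τ i.castSucc) (JFacts M x b w t z a c τ)
        (tgtStarL (Letters.perc d p) (κ i.castSucc) a' (b i.castSucc).1 (w i.castSucc) (t i.castSucc) (z i.castSucc)
          (w i.succ) (b i.succ).1 (τ i)))) :
    ∑' x, nobleXiT d p (M + 2) x ≤
      vecP (starS (blockPS (Letters.perc d p))) ᵥ*
        matB (starB (blockBFullB' (Letters.perc d p) X₂) (secEc (blockBFullpt' (Letters.perc d p) X) 0)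
          (secEo (blockBFullpt' (Letters.perc d p) X) 2) (secEoc (blockBFullpt' (Letters.perc d p) X) 2 0)) ^ (M + 1) ᵥ*
          matAbar (starA (blockAbar' (Letters.perc d p)) (secEA (blockAbar' (Letters.perc d p)) 2)) ⬝ᵥ
        vecP (starS (blockPE (Letters.perc d p))) :=
  tsum_nobleXiT_le_secStarB'_of_pairPackages p M X X₂ hXsum hX₂ti hXti
    (fun x a c b w t z κ hκ τ hτ a₀ a' ha ha' => nonempty_jPkg_first_regB p M x b w t z a c τ (κ _) (hκ _) a₀ a' ha ha'
      (hR'₀ x a c b w t z κ hκ τ hτ a₀ a' ha ha') (hR₀ x a c b w t z κ hκ τ hτ a₀ a' ha ha'))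
    (fun x a c b w t z κ hκ τ hτ i i₀ hk a₀ a' ha ha' => nonempty_jPkg_mid_regB p M x b w t z a c τ i i₀ hk (κ _) (hκ _)
      a₀ a' ha ha' (hR' x a c b w t z κ hκ τ hτ i i₀ hk a₀ a' ha ha') (hR x a c b w t z κ hκ τ hτ i i₀ hk a₀ a' ha ha'))
    fun x a c b w t z κ hκ τ hτ i i₀ hk u₀ a' ha ha' => nonempty_jPkg_mid_starL' p M x b w t z a c τ i i₀ hk (κ _) (hκ _)
      ha a' ha' (hR'L x a c b w t z κ hκ τ hτ i i₀ hk u₀ a' ha ha') (hRL x a c b w t z κ hκ τ hτ i i₀ hk u₀ a' ha ha')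

end Residual

end Literature.Probability.FitznerVanDerHofstad2017

end
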